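import Mathlib
import HarnessLib
import HarnessLib.Audit
import Summits.AtomisticToContinuum.Statement
import Literature.Barriers.AtomisticToContinuum.FixedLengthNoConductivityControl
import Literature.MathematicalPhysics.KineticTheory.LangevinChainNESS
import Literature.MathematicalPhysics.KineticTheory.HarmonicChainNESS
import Literature.MathematicalPhysics.KineticTheory.HarmonicChainFlux
import Summits.AtomisticToContinuum.FouriersLaw.Theorems.EmbeddedDrudeMourreNessUnique
import Summits.AtomisticToContinuum.FouriersLaw.Theorems.FourierGreenKuboFourierFiniteResponseOfUnique

/-!
Route: MatthiessenIncrements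

CLOSED (retired) 2026-08-15T13:44:36Z by operator:999:1257524 — reason: not-a-thesis: assembly does not conclude the sub-problem Statement — note: D-0027 §2.1 audit (human 2026-08-15: routes that do not decide the summit are removed): the assembly concludes `Literature.MathematicalPhysics.KineticTheory.HeatConduction.FouriersLaw`, not the sub-problem statement; a NEW conforming route may be opened from the same idea (generated `closes : … → _r. The file is kept as the record of this route; refuted decls are indexed as negative knowledge (`ledger negatives`).

# Route MatthiessenIncrements — bounded response from Matthiessen increments — N-uniform bounds on
the resistance added by one quartic cell at the moving harmonic/anharmonic interface, telescoped
from the solved harmonic chain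

X_M (MATTHIESSEN-INCREMENT LINE; realises idea card
AtomisticToContinuum/FouriersLaw/matthiessen-increments-over-anharmonic-sites).
Fix ω₂, lam, β, γ > 0 and T > 0. For a CELL PROFILE c : ℕ → [0,1] let P^c be the Langevin-driven
chain with on-site potential
U_i(q) = ω₂q²/2 + c_i·lam·q⁴/4 and coupling V_(i,i+1)(r) = r²/2 + c_i·β·r⁴/4 (cell i = site-i
pinning + bond (i,i+1); same baths,
generator, bond currents and weak steady-state class as OscillatorChain — for constant c ≡ a it is
DEFINITIONALLY pinnedChain ω₂ (a·lam) (a·β) γ,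
so c ≡ 1 is the conjunct's chain and c ≡ 0 the exactly solved harmonic chain, conductance fluxCoeff
ω₂ γ N → fluxLimit > 0). Write D_N(c) for the
finite-N linear-response coefficient of clause (ii) and R_N(c) := (N−1)/D_N(c) for the bath-to-bath
thermal RESISTANCE. Interpolate between the
harmonic member and the conjunct NOT in the coupling strength (blocked: low T = weak anharmonicity)
but in the SUPPORT of the anharmonicity, along
the prefix ladder c = 1_[0,k), k = 0 … N (one quartic cell switched on at a time, the
harmonic/anharmonic interface moving right by one cell; every
intermediate chain keeps interaction degree ≥ pinning degree at every site). It suffices to show X_M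
= (M) ∧ (I) ∧ frame:
 (M) MixedSteadyStates — for every profile c, weak steady states of P^c exist and are unique for all
N, T_L, T_R > 0, and the response D_N(c) exists;
 (I) PrefixIncrementBounds — ∃ 0 < r_min ≤ r_max, k₀, N₀ (depending on ω₂, lam, β, γ, T only): for N
≥ N₀ and k < N the increment
     Δ_N(k) := R_N(1_[0,k+1)) − R_N(1_[0,k)) satisfies |Δ_N(k)| ≤ r_max always and Δ_N(k) ≥ r_min
whenever k₀ ≤ k ≤ N−1−k₀ (Matthiessen: every
     quartic cell switched on in the bulk ADDS at least r_min and at most r_max of resistance), with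
D_N > 0 for both chains;
 frame (shared verbatim with route FeketeResistance): NessUnique (U), FiniteResponseOfUnique (F),
PositiveConductance (P), QuasiSubadditiveResistance (S),
     FeketeGlue, and the landed fact CuneoEckmannHairerReyBellet2018_pinnedChain.
Telescoping (I) over k = 0 … N−1 (support item IncrementGlue, via ProfileCalibration) gives
R_N(conjunct) ≥ 1/fluxCoeff_N + (N − 2k₀)·r_min − 2k₀·r_max,
i.e. D_N ≤ 2/r_min for N large: exactly the catalogued waypoint HasBoundedResponse (item
BoundedResponse, stmt-2187, the one input the Fekete frame
does NOT produce and for which FeketeResistance claims no engine). Then (S)+(P)+FeketeGlue give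
R_N/N → ℓ ≥ r_min/2 > 0 and D_N → κ(T) := 1/ℓ ∈ (0, 2/r_min];
clause (i) is the landed fact + (U); FouriersLaw follows for all parameters. SingleImpurity (one
quartic cell deep inside the harmonic chain: r_min ≤
R_N(1_{x}) − 1/fluxCoeff_N ≤ r_max, N-uniform) is the first rung / probe of the mechanism, stated
against the explicit harmonic solution.
Lean: `FeketeGlue →
Literature.MathematicalPhysics.KineticTheory.HeatConduction.CuneoEckmannHairerReyBellet2018_pinnedChain
→ NessUnique → FiniteResponseOfUnique → PositiveConductance → QuasiSubadditiveResistance →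
MixedSteadyStates → PrefixIncrementBounds →
Literature.MathematicalPhysics.KineticTheory.HeatConduction.FouriersLaw`

## Assembly
Fix parameters > 0. Clause (i): existence from the landed fact (N ≥ 1) /
OscillatorChain.isSteadyState_zero (N = 0) + NessUnique. Clause (ii): pick the
canonical family μ₀ (choice) and D₀(T) from FiniteResponseOfUnique; IncrementGlue (support;
telescoping PrefixIncrementBounds over the prefix ladder
supplied by MixedSteadyStates, ends identified by ProfileCalibration) gives HasBoundedResponse, |D₀
N| ≤ S; PositiveConductance makes a_N := (N−1)/D₀ N a
resistance with a_N ≥ (N−1)/max(S,1); QuasiSubadditiveResistance + FeketeGlue give a_N/N → ℓ(T) > 0,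
so D₀ N = ((N−1)/N)/(a_N/N) → κ(T) := 1/ℓ(T) > 0
(κ T := 1 for T ≤ 0); any other steady-state family has the same difference quotients once T ± δ/2 >
0 (uniqueness; Filter.Tendsto.congr', as in
hasBoundedResponse_iff_of_unique); conclude with
Literature.HeatConduction.fouriersLaw_of_steadyState_and_linearResponse
(Theorems/FourierGreenKuboAssembly)
or directly. Formally Assembly = (FeketeResistance.Assembly, whose glue was planner-verified rc 0
there) ∘ IncrementGlue; standard reductions only.

Rationale: WHY THIS LINE. Resistances localise while conductances do not: one scatterer in a ballistic
background changes ⟨J,(−L)⁻¹J⟩ by O(N²) but the resistance R by O(1),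
so the resistance INCREMENT per switched-on quartic cell is the additive variable for an induction
over the anharmonic set — Matthiessen's rule
(resistivities of independent scattering mechanisms add; deviations non-negative by Kohler's
variational principle, Ziman 1960 ch. 9) turned into
a two-sided N-uniform inequality whose induction BASE is the exactly solved, PROVED-in-tree harmonic
member (HarmonicChainBallisticFlux_holds,
fluxCoeff_eq, tendsto_fluxCoeff: RoyDhar2008 (2.8), BonettoLebowitzReyBellet2000 §6.2) — the refuted
corner enters positively. The ladder is the
PREFIX (moving-interface) one, not the card's arbitrary-Λ one: moving the single harmonic/anharmonic
interface by one cell adds one bulk cell of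
resistivity and changes neither the number of interfaces nor the ballistic lead's resistance, so no
Kapitza/interference sign competition arises
(interface thermal resistance between dissimilar anharmonic lattices:
doi:10.1103/physrevlett.95.104302, doi:10.1088/1361-648x/adee6f), and every
intermediate chain satisfies the Cuneo–Eckmann–Hairer–Rey-Bellet degree condition cellwise. Imported
areas: mesoscopic transport (Landauer picture,
series/Matthiessen composition of resistances, phonon transmittance through nonlinear atomic-scale
defects: doi:10.1103/8k6j-kmlj,
doi:10.1103/physreve.107.054217, TerraneoPeyrardCasati doi:10.1103/physrevlett.88.094302) supplies
the heuristics; the single-impurity rung is one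
nonlinear oscillator cell between two Gaussian (Rubin/harmonic-lead) fields —
EckmannPilletReyBellet1999b with n = 1, Komech doi:10.1016/j.physleta.2009.01.054,
arXiv:2510.20003 — whose linear-response conductance must be shown strictly and N-uniformly below
the ballistic fluxCoeff. What it does that the open
routes do not: FourierGreenKubo needs infinite-volume Green–Kubo;
FeketeResistance/SuperadditiveJunction cut chains IN THE LENGTH and re-thermalise
(and FeketeResistance explicitly claims no engine for BoundedResponse); LocalOhmRigidity works on
the homogeneous chain's temperature profile; this
line never leaves finite volume, never re-thermalises, and changes the CHAIN (support of the
nonlinearity) at fixed N, pinned to the solved harmonic end.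

RANKED CRUXES. #2 PrefixIncrementBounds (crux) — MATTHIESSEN INCREMENTS ALONG THE PREFIX LADDER
(card item IncrementBounds, moving-interface form). For ω₂, lam, β, γ > 0 and T > 0 there are 0 <
r_min ≤ r_max and k₀, N₀ such that for all N ≥ N₀, k < N, and all response coefficients D₀ of
P^{1_[0,k)} and D₁ of P^{1_[0,k+1)} at size N and temperature T (each along some weak-steady-state
family over the bath temperatures): D₀, D₁ > 0, |(N−1)/D₁ − (N−1)/D₀| ≤ r_max, and (N−1)/D₁ −
(N−1)/D₀ ≥ r_min whenever k₀ ≤ k and k + k₀ < N. The mixed chain is written inline (let-bound U, V,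
H, L, J, SS, Resp copying
OscillatorChain.hamiltonian/generator/bondCurrent/IsSteadyState/totalCurrent with cell profile c;
definitionally pinnedChain for constant c, see ProfileCalibration). Candidate engines: resistance as
a constrained Thomson/Dirichlet saddle for L = A_H + γS with the rank-one locality of A_{k+1} − A_k
= {h_k, ·} (LandimMarianiSeo2018-type principles); Landauer/transfer picture across the interface
with the harmonic lead as an explicit Gaussian (Rubin) bath; first-order NESS perturbation theory in
the added cell (LefevereSchenkel arXiv:math-ph/0303050). [deps: MixedSteadyStates] [difficulty:
open-problem] (why it might fail: Locality may fail coherently: at low T (mean free path ≫ k₀) the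
interface increment need not be Θ(1) uniformly in (N,k); |ΔR| ≤ r_max is an N-uniform
Lipschitz-in-support bound unproved for any anharmonic chain; contact interference for cells near
the baths is only fenced by k₀.) [BonettoLebowitzReyBellet2000, doi:10.1103/physrevlett.95.104302,
doi:10.1088/1361-648x/adee6f, LandimMarianiSeo2018, arXiv:math-ph/0303050, LepriLiviPoliti2003,
Dhar2008]
#3 SingleImpurity (crux) — FIRST RUNG — ONE QUARTIC CELL IN THE HARMONIC CHAIN HAS N-UNIFORM
POSITIVE, BOUNDED EXCESS RESISTANCE (card item SingleImpurity). For ω₂, lam, β, γ > 0 and T > 0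
there are 0 < r_min ≤ r_max, k₀, N₀ with: for all N ≥ N₀ and sites x with k₀ ≤ x, x + k₀ < N, every
response coefficient D of the chain P^{1_{x}} (harmonic except U_x = ω₂q²/2 + lam q⁴/4, V_(x,x+1) =
r²/2 + βr⁴/4) at size N and temperature T satisfies D > 0 and r_min ≤ (N−1)/D − 1/fluxCoeff ω₂ γ N ≤
r_max, where 1/fluxCoeff ω₂ γ N = R_N(harmonic) is the explicit ballistic resistance (fluxCoeff_eq;
harmonicNESS, integral_bondCurrent_harmonicNESS_eq_fluxCoeff in tree). Physically: the
linear-response conductance of lead–quartic cell–lead is strictly and uniformly below the ballistic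
value (an anharmonic cell at temperature T detunes/reflects part of the thermal phonon flux: Hartree
shift 3·lam·⟨q²⟩ ⇒ reflection ∝ (lamT)² at leading order) and uniformly positive (V'' ≥ 1: no cell
is a mirror). Technology: one nonlinear oscillator cell driven by two stationary Gaussian fields =
finite harmonic half-chains ending in Langevin baths (explicit covariance chainCov), n = 1 case of
Eckmann–Pillet–Rey-Bellet; nonlinear Lamb/Rubin scattering. Not in the assembly chain: it is the
probe of r_min > 0 whose failure kills the line and whose proof builds the interface technology of
PrefixIncrementBounds. [deps: MixedSteadyStates] [difficulty: L] (why it might fail: A quartic cell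
may be asymptotically transparent: inelastic redistribution without net reflection, or excess
resistance → 0 along N via lead resonances at the band edges; near-contact interference only fenced
by k₀; no printed theorem compares the n = 1 conductance with fluxCoeff.)
[EckmannPilletReyBellet1999b, doi:10.1016/j.physleta.2009.01.054, doi:10.1103/8k6j-kmlj,
doi:10.1103/physreve.107.054217, doi:10.1103/physrevlett.88.094302, arXiv:2510.20003, RoyDhar2008,
arXiv:math-ph/0303050]
#4 MixedSteadyStates (crux) — STEADY STATES AND FINITE RESPONSE OF THE MIXED CHAINS (infrastructure
that de-vacuifies the two cruxes above; card item (0)). For ω₂, lam, β, γ > 0 and every cell profile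
c : ℕ → [0,1]: for all N and T_L, T_R > 0 the chain P^c has a weak steady state (probability
measure, ∫ L^c f dμ = 0 for f ∈ C_c^∞, bond currents integrable) which is unique in that class, and
for every N and T > 0 some steady-state family over the bath temperatures has a linear-response
limit D = lim_{δ→0,δ≠0} Σ_i μ_{T+δ/2,T−δ/2}(j_i^c)/δ. For constant c this is NessExistsUnique (0706)
+ FiniteResponseOfUnique (0717) of pinnedChain ω₂ (c·lam) (c·β) γ (existence landed:
CuneoEckmannHairerReyBellet2018_pinnedChain_holds); for general c the Lyapunov/H2 construction of
LangevinChain*.lean must be redone with site-dependent coefficients (interaction degree ≥ pinning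
degree holds cellwise since pinning and coupling quartics are switched on together), uniqueness
needs the same Fokker–Planck identification lemma as NessUnique (0741), and the response limit the
Hairer–Majda / Rey-Bellet finite-volume linear-response argument. [difficulty: L] (why it might
fail: Weak-class uniqueness has the same unprinted FP-identification gap as NessUnique; existence
for non-constant profiles is outside CEHR2018's printed C3 (uniform degrees); a quartic-pinned site
with a harmonic left bond (profile jump) may dissipate slowly (HairerMattingly2009).)
[CuneoEckmannHairerReyBellet2018, Carmona2007, HairerMattingly2009, ReyBellet2003, HairerMajda2009]
#9 ProfileCalibration (support) — CALIBRATION OF THE INLINE MIXED CHAIN (provable now;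
planner-verified: the constant-profile clauses hold by Iff.rfl/rfl in Sketch.lean). (a) Locality in
the profile: if c i = c' i for all i < N then at size N the weak steady-state predicates of P^c and
P^{c'} coincide and their bond currents are equal; (b) for a constant profile c ≡ a the steady-state
predicate IS (pinnedChain ω₂ (a·lam) (a·β) γ).IsSteadyState and the bond current IS its bondCurrent
(so a = 1: the conjunct's chain up to one_mul; a = 0: the solved harmonic chain up to zero_mul).
Used by IncrementGlue to identify the two ends of the prefix ladder. [difficulty: provable-now]
[BonettoLebowitzReyBellet2000]
#9 IncrementGlue (support) — TELESCOPING GLUE (the foreseen split of BoundedResponse in this route;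
finite sums + ProfileCalibration, provable once stated): PrefixIncrementBounds → MixedSteadyStates →
BoundedResponse. Given a steady-state family μ of pinnedChain ω₂ lam β γ, T > 0 and its response
coefficients D: for N ≥ max(N₀, 2) pick by MixedSteadyStates response coefficients D^(k) of
P^{1_[0,k)} (k ≤ N; for k = N use D N itself via ProfileCalibration (a)+(b) with a = 1, for k = 0
any response of the harmonic chain, positive by the crux); summing the increments, R_N := (N−1)/D N
≥ (N−1)/D^(0) + (N − 2k₀)·r_min − 2k₀·r_max ≥ (N/2)·r_min for N ≥ N₁, hence 0 < D N ≤ 2/r_min;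
finitely many N < N₁ are absorbed in the bound; so BddAbove (range |D N|) for every family, i.e.
HasBoundedResponse. [difficulty: provable-now] [BonettoLebowitzReyBellet2000,
Literature.Barriers.AtomisticToContinuum.HasBoundedResponse]
#9 BoundedResponse (support) — THE NODE THIS ROUTE'S CRUXES GLUE INTO (shared verbatim with
FeketeResistance's crux stmt-2187): for all ω₂, lam, β, γ > 0, HasBoundedResponse (pinnedChain ω₂
lam β γ) — |D_N| bounded along every steady-state family (κ_N bounded in N; BLR2000 §6.3 'nothing is
known about the dependence of D on L'); necessary for the conjunct
(hasBoundedResponse_of_fouriersLawFor, proved) and false at lam = β = 0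
(HarmonicChainBallisticFlux.not_hasBoundedResponse, proved). Closed in this route by IncrementGlue;
a direct proof by any other route equally serves the Fekete frame. [difficulty: open-problem]
[BonettoLebowitzReyBellet2000, BonettoLebowitzLukkarinenOlla2009, CanestrariLiveraniOlla2026]
#9 QuasiSubadditiveResistance (support) — IMPORTED LIMIT ENGINE (FeketeResistance's rank-2 crux
stmt-2186, shared verbatim; not this route's mechanism): under weak-NESS uniqueness, for every
steady-state family, T > 0 and response coefficients D: ∃ C ∀ N, M ≥ 2, (N+M−1)/D_{N+M} ≤ (N−1)/D_N
+ (M−1)/D_M + C (series law with bounded junction defect). With FeketeGlue it turns BoundedResponse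
+ PositiveConductance into D_N → κ(T) ∈ (0, ∞). This route's own candidate replacement
(Matthiessen's rule proper: convergence of the bulk increments Δ_N(k) → r_∞(T), giving R_N/N → r_∞
directly) is deliberately not filed (see Not decomposed yet). [difficulty: open-problem]
[LandimMarianiSeo2018, KunduDharNarayan2009, ReyBellet2003, ArmstrongKuusiMourrat2019]
#9 PositiveConductance (support) — SHARED (FeketeResistance stmt-2188): under weak-NESS uniqueness,
along every steady-state family and T > 0, the response coefficients satisfy D_N > 0 for N ≥ 2
(non-degenerate finite-volume Kubo variance). Needed so that R_N = (N−1)/D_N is a resistance in the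
Fekete step; the mixed-chain analogue is folded into the conclusions of
PrefixIncrementBounds/SingleImpurity. [difficulty: M] [ReyBellet2003, EckmannPilletReyBellet1999b,
KunduDharNarayan2009]
#9 FiniteResponseOfUnique (support) — SHARED (stmt-0717, routes
FourierGreenKubo/FeketeResistance/SuperadditiveJunction/LocalOhmRigidity): under weak-NESS
uniqueness the finite-N linear-response limit D_N(T) of pinnedChain exists for every steady-state
family, T > 0 and N (Hairer–Majda / Rey-Bellet finite-volume linear response). [difficulty: M]
[ReyBellet2003, HairerMajda2009]
#9 NessUnique (support) — SHARED (stmt-0741): uniqueness of the weak steady state of pinnedChain ω₂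
lam β γ (all > 0) in the class IsSteadyState for all N, T_L, T_R > 0 (CEHR2018 Thm 2.13(1) for the
semigroup's invariant measure + the Fokker–Planck identification lemma); with the landed existence
fact it is clause (i). [difficulty: M] [CuneoEckmannHairerReyBellet2018, Carmona2007]
#9 FeketeGlue (support) — SHARED (FeketeResistance stmt-2189; pure real analysis, provable today):
Fekete's lemma with additive defect on the index semigroup {n ≥ 2}: a(n+m) ≤ a n + a m + C (n, m ≥
2) and (n−1)/S ≤ a n (n ≥ 2, S > 0) ⇒ a n/n → ℓ > 0. [difficulty: provable-now] [Hammersley1988,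
Mathlib: Subadditive.tendsto_lim]

TWO-LAYER PLAN. Foreseen glued splits (nothing filed beyond the support items above):
BoundedResponse ⇐ PrefixIncrementBounds → MixedSteadyStates → BoundedResponse
(glue = IncrementGlue, already stated). After SingleImpurity closes: PrefixIncrementBounds ⇐
InterfaceLocality (|Δ_N(k)| ≤ r_max: moving the interface
by one cell is an O(1) perturbation of the resistance, a Lipschitz-in-support statement) →
BulkIncrementPositivity (Δ_N(k) ≥ r_min for bulk cells,
the Matthiessen sign) → PrefixIncrementBounds (k = 2). After MixedSteadyStates closes for
{0,1}-profiles, its [0,1]-profile generality may be dropped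
by a resplit if unused. Once the definition request SiteDependentChain lands, all three mixed-chain
items are restated over it 1:1 (same meaning,
shorter signatures).

KILL CRITERIA. Refutation of PrefixIncrementBounds by an N-sequence of bulk increments Δ_N(k_N) → 0
or < 0 at fixed T (nonequilibrium MD is admissible evidence for a
pivot, a theorem closes): close --reason refuted:PrefixIncrementBounds unless the failure is
confined to a window k₀ that can be enlarged (then restate
with the measured k₀). Refutation of SingleImpurity (a quartic cell asymptotically transparent in
the harmonic chain at some T) kills the Matthiessen
picture outright: close the route. Refutation of MixedSteadyStates by NON-UNIQUENESS for some
profile forces a pivot to {0,1}-prefix profiles only or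
to the semigroup's invariant measure; by NON-EXISTENCE for prefix profiles closes the route. A proof
of ¬HasBoundedResponse (hidden conserved quantity,
Mazur) refutes BoundedResponse and the conjunct itself (then ¬FouriersLaw is filed). A proof of
BoundedResponse elsewhere moots this route's engine
but not its items SingleImpurity/PrefixIncrementBounds as theorems about mixed chains (they would be
released, not refuted).

NOT DECOMPOSED YET. The engine of PrefixIncrementBounds (variational saddle vs. transfer/Landauer
across the interface vs. first-order NESS perturbation in the added
cell); Matthiessen's rule PROPER (convergence Δ_N(k) → r_∞(T) for bulk cells, which would replace
the imported QuasiSubadditiveResistance by this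
line's own limit engine and identify κ = 1/r_∞) — deliberately unfiled: it is a differentiated
Fourier law for junction chains, strictly stronger
than needed; the card's arbitrary-Λ and averaged-over-x increment conjectures — unfiled: pointwise
increments for dense Λ at low T are a competition
of two O((lamT)²) effects (elastic reflection by a one-cell frequency defect vs. the bulk
resistivity of one cell) with unrelated constants, an
inessential refutation risk the prefix ladder avoids; the T-dependence of r_min, r_max (allowed to
degenerate as T → 0, (lamT)² expected); boundary
cells (fenced by k₀, never analysed); the explicit value of R_N(harmonic) is used only in
SingleImpurity's normalisation, not in the glue.

CHEAPEST FALSIFIER. Nonequilibrium (or equilibrium Green–Kubo) molecular dynamics of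
pinnedChain(1,1,1,1)-type mixed chains at T = 1 and T = 0.1: N ∈ {32, 64, 128},
prefix ladder k = 0 … N, measure R_N(k) = (N−1)δT/J_N(k) at δT/T = 0.1: are the bulk increments
Δ_N(k) positive, O(1), N-independent, and roughly
constant in k (slope = 1/κ(T) of the homogeneous chain, LepriLiviPoliti2003 §6 / Aoki–Kusnezov
boundary-jump phenomenology)? Any reproducible NEGATIVE
or VANISHING bulk increment at moderate T retires PrefixIncrementBounds; a single-impurity
conductance indistinguishable from fluxCoeff_N as N grows
retires SingleImpurity. Analytic sanity check a refuter can do on paper: first order in (lam, β) of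
the single-cell excess resistance at high ω₂
(Lefevere–Schenkel NESS perturbation theory, arXiv:math-ph/0303050) — the O(lam) term must vanish
(odd/Hartree renormalisation is reflectionless
to first order only if …) and the O(lam²) coefficient must be positive. kit compute was not run by
this planner (plancard seat, one-shot).

NUMBERS. Harmonic base (in tree): c_N = fluxCoeff ω₂ γ N = γ/(2(1+γ²))·(r + r^{2N−2})/(1 +
r^{2N−1}), 0 < r = rootR ω₂ γ < 1, c_N → fluxLimit = γ r/(2(1+γ²)) > 0
(RoyDhar2008 (2.8)); so R_N(harmonic) = 1/c_N is bounded and D_N(harmonic) = (N−1)c_N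
(HarmonicChainBallisticFlux.ballisticLaw). Conjunct numerics:
κ ~ (lamT)^{-1.35…-2} for pinned quartic chains (AokiLukkarinenSpohn2006; Aoki–Kusnezov), boundary
jumps R_N ≈ (N + 2εℓ)/κ (LepriLiviPoliti2003 §3.4),
so the expected bulk increment is r_∞(T) = 1/κ(T) and r_min(T), r_max(T) must be allowed to
vanish/blow up as T → 0 (scaling conjugacy
D_N(T; lam, β) = D_N(1; lamT, βT), lowTemperatureWeakAnharmonicity_holds).

DEFINITION REQUESTS. SiteDependentChain (topic Literature/MathematicalPhysics/KineticTheory): the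
Cuneo–Eckmann–Hairer–Rey-Bellet oscillator NETWORK restricted to the path
graph — data (U V : ℕ → ℝ → ℝ, γ : ℝ), with
hamiltonian/generator/bondCurrent/totalCurrent/IsSteadyState copied from OscillatorChain with U ↦ U
i.val,
V ↦ V i.val, the coercion from OscillatorChain (constant families) with rfl-level agreement lemmas,
and mixedPinnedChain ω₂ lam β γ (c : ℕ → ℝ) :=
⟨fun i q => ω₂q²/2 + c i·lam·q⁴/4, fun i r => r²/2 + c i·β·r⁴/4, γ⟩ (CuneoEckmannHairerReyBellet2018
§2 eq. (2.1)–(2.2): vertex potentials U_v, edge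
potentials V_e). Filed with `ledger workitem add --kind definition` for MixedSteadyStates; when it
lands the three mixed-chain items are restated over
it (same meaning). No cite facts are requested: the harmonic base and the CEHR existence fact are
PROVED in tree.

Novelty: Searches (2026-08-15, this planner, on top of the card's and the novelty audit's searches recorded
on the card): `lit frontier AtomisticToContinuum --since 2020`
(30 rows; relevant: arXiv:2310.13338 CLO2026, arXiv:2510.20003 particle + harmonic thermal bath AHP
2026, arXiv:2604.14056, arXiv:2606.08839, arXiv:2605.24268
site-dependent α-FPUT), `lit bridges AtomisticToContinuum --cross any` (no bridge on impurity
scattering / resistance increments), `lit search --source crossref`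
×7: "anharmonic defect harmonic chain heat conduction thermal resistance"
(doi:10.1103/physrevlett.96.100601 Pereira–Falcao 2006, doi:10.1103/physrevlett.86.5882),
"interface thermal resistance between dissimilar anharmonic lattices"
(doi:10.1103/physrevlett.95.104302 Li–Lan–Wang 2005, 400 cit; doi:10.1088/1361-648x/adee6f
Romero-Bastida–Martínez-Torres 2025; doi:10.1142/s0217979207045116), "Kosevich nonlinearity phonon
transmittance …" (doi:10.1103/8k6j-kmlj Koroleva–Kosevich 2026,
doi:10.1103/physreve.107.054217, doi:10.1103/physrevb.89.180301), "nonlinear lattice segment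
sandwiched between harmonic chains …" (doi:10.1016/j.physa.2014.12.018,
doi:10.1103/physreve.93.032127), "thermal transport through anharmonic junction between harmonic
leads self-consistent" (doi:10.1103/physreve.77.062102 Roy 2008),
"Matthiessen rule deviations variational principle Kohler" (doi:10.1007/bf02422837,
doi:10.1103/physrev.135.a1081); `lit vsearch` on the single-impurity statement
(textbook noise only); local `lit sear  [refs: 10.1103/physrevlett.96.100601, 10.1103/physrevlett.86.5882, 10.1103/physrevlett.95.104302, 10.1088/1361-648x/adee6f, 10.1142/s0217979207045116, 10.1103/8k6j-kmlj, 10.1103/physreve.107.054217, 10.1103/physrevb.89.180301, 10.1016/j.physa.2014.12.018, 10.1103/physreve.93.032127, 10.1103/physreve.77.062102, 10.1007/bf02422837, 10.1103/physrev.135.a1081, 10.1103/physrevlett.88.094302, 10.1016/j.physlet]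

Barriers (technique_class: matthiessen-increments, site-set-interpolation, impurity): - technique_class: matthiessen-increments, site-set-interpolation, impurity
- Literature.Barriers.AtomisticToContinuum.HarmonicChainBallisticFlux: used POSITIVELY as the
induction base (R_N(1_[0,0)) = 1/fluxCoeff_N, bounded): the line asserts that every bulk quartic
cell switched on raises the resistance by ≥ r_min, so the harmonic member is the least resistive
chain of the ladder, consistent with its ballistic flux; nothing is claimed uniformly in lam, β ≥ 0
(exists_not_fouriersLawFor respected).
- Literature.Barriers.AtomisticToContinuum.LowTemperatureWeakAnharmonicity: evaded by design — the
interpolation runs in the SUPPORT of the nonlinearity at FIXED (lam, β, T), never in its size;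
r_min(T) → 0 and r_max(T), k₀(T), N₀(T) → ∞ as T → 0 are allowed (scaling conjugacy
lowTemperatureWeakAnharmonicity_holds: (lamT)² expected), so no estimate is uniform at the harmonic
corner.
- Literature.Barriers.AtomisticToContinuum.HasBoundedResponse: met with a mechanism, not bypassed —
it is exactly the node IncrementGlue closes (item BoundedResponse); the increments are statements
comparing chains of the SAME length with different nonlinearity supports, hence outside the fixed-N
ness-analysis class the barrier documents (whose theorems never compare two chains).
- Literature.Barriers.AtomisticToContinuum.AjankiHuveneers2011_scaling: the known NEGATIVE
increments (anharmonicity/noise raising transport) live on LOCALISED disordered harmonic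
backgrounds; every P^c here is ordered with harm

History (route lifecycle, newest last):
- 2026-08-15T13:44:36Z · CLOSED retired — not-a-thesis: assembly does not conclude the sub-problem Statement (operator:999:1257524)

sub-problem: FouriersLaw · status: closed(retired) · opened planner-plancard-AtomisticToContinuum-Fourier-dd2f4716-0 2026-08-15T11:21:01Z · rev 0 · ledger route-AtomisticToContinuum-MatthiessenIncrements
GENERATED by the gate from the ledger (D-0016/17). Provers cite these decls: `theorem foo : Summit.AtomisticToContinuum.FouriersLaw.Theses.MatthiessenIncrements.<Decl> := …` in Summits/AtomisticToContinuum/FouriersLaw/Theorems/<Name>.lean.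
-/

namespace Summit.AtomisticToContinuum.FouriersLaw.Theses.MatthiessenIncrements

open scoped BigOperators Topology Manifold Classical MeasureTheory ProbabilityTheory Matrix InnerProductSpace ComplexConjugate ContinuousMap
open Filter Set Function TopologicalSpace MeasureTheory

attribute [summit_statement] _root_.FouriersLaw

/-- item stmt-AtomisticToContinuum-3610 · crux · rank 2 · closed · moot by None · by planner
why it might fail: Locality may fail coherently: at low T (mean free path ≫ k₀) the interface increment need not be Θ(1) uniformly in (N,k); |ΔR| ≤ r_max is an N-uniform Lipschitz-in-support bound unproved for any anharmonic chain; contact interference for cells near the baths is only fenced by k₀.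
sources: BonettoLebowitzReyBellet2000, doi:10.1103/physrevlett.95.104302, doi:10.1088/1361-648x/adee6f, LandimMarianiSeo2018, arXiv:math-ph/0303050, LepriLiviPoliti2003
[crux] MATTHIESSEN INCREMENTS ALONG THE PREFIX LADDER (card item IncrementBounds, moving-interface
form). For ω₂, lam, β, γ > 0 and T > 0 there are 0 < r_min ≤ r_max and k₀, N₀ such that for all N ≥
N₀, k < N, and all response coefficients D₀ of P^{1_[0,k)} and D₁ of P^{1_[0,k+1)} at size N and
temperature T (each along some weak-steady-state family over the bath temperatures): D₀, D₁ > 0,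
|(N−1)/D₁ − (N−1)/D₀| ≤ r_max, and (N−1)/D₁ − (N−1)/D₀ ≥ r_min whenever k₀ ≤ k and k + k₀ < N. The
mixed chain is written inline (let-bound U, V, H, L, J, SS, Resp copying
OscillatorChain.hamiltonian/generator/bondCurrent/IsSteadyState/totalCurrent with cell profile c;
definitionally pinnedChain for constant c, see ProfileCalibration). Candidate engines: resistance as
a constrained Thomson/Dirichlet saddle for L = A_H + γS with the rank-one locality of A_{k+1} − A_k
= {h_k, ·} (LandimMarianiSeo2018-type principles); Landauer/transfer picture across the interface
with the harmonic lead as an explicit Gaussian (Rubin) bath; first-order NESS perturbation theory in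
the added cell (LefevereSchenkel arXiv:math-ph/0303050). [deps: MixedSteadyStates] [difficulty:
open-problem] -/
@[route_item "route-AtomisticToContinuum-MatthiessenIncrements"]
def PrefixIncrementBounds : Prop :=
  ∀ ω₂ lam β γ : ℝ, 0 < ω₂ → 0 < lam → 0 < β → 0 < γ → let U : (ℕ → ℝ) → ℕ → ℝ → ℝ := fun c i q => ω₂ * q ^ 2 / 2 + c i * lam * q ^ 4 / 4; let V : (ℕ → ℝ) → ℕ → ℝ → ℝ := fun c i r => r ^ 2 / 2 + c i * β * r ^ 4 / 4; let H : (ℕ → ℝ) → (N : ℕ) → Literature.MathematicalPhysics.KineticTheory.HeatConduction.PhaseSpace N → ℝ := fun c N x => (∑ i : Fin N, (x.2 i ^ 2 / 2 + U c i.val (x.1 i))) + ∑ i : Fin N, ∑ j : Fin N, (if j.val = i.val + 1 then V c i.val (x.1 j - x.1 i) else 0); let L : (ℕ → ℝ) → (N : ℕ) → ℝ → ℝ → (Literature.MathematicalPhysics.KineticTheory.HeatConduction.PhaseSpace N → ℝ) → Literature.MathematicalPhysics.KineticTheory.HeatConduction.PhaseSpace N → ℝ := fun c N T_L T_R f x =>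 (∑ i : Fin N, (x.2 i * Literature.MathematicalPhysics.KineticTheory.HeatConduction.partialQ i f x - Literature.MathematicalPhysics.KineticTheory.HeatConduction.partialQ i (H c N) x * Literature.MathematicalPhysics.KineticTheory.HeatConduction.partialP i f x)) + γ * ∑ i : Fin N, ((if i.val = 0 then T_L * Literature.MathematicalPhysics.KineticTheory.HeatConduction.partialP i (Literature.MathematicalPhysics.KineticTheory.HeatConduction.partialP i f) x - x.2 i * Literature.MathematicalPhysics.KineticTheory.HeatConduction.partialP i f x else 0) + (if i.val = N - 1 then T_R * Literature.MathematicalPhysics.KineticTheory.HeatConduction.partialP i (Literature.MathematicalPhysics.KineticTheory.HeatConduction.partialP i f) x - x.2 i * Literature.MathematicalPhysics.KineticTheory.HeatConduction.partialP i f x else 0)); let J : (ℕ → ℝ) → (N : ℕ) → Fin N → Literature.MathematicalPhysics.KineticTheory.HeatConduction.PhaseSpace N → ℝ := fun c N i x => ∑ j : Fin N, (if j.val = i.val + 1 then -((x.2 i + x.2 j) / 2 * deriv (V c i.val) (x.1 j - x.1 i)) else 0); let SS : (ℕ → ℝ) → (N : ℕ) → ℝ → ℝ → MeasureTheory.Measure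 (Literature.MathematicalPhysics.KineticTheory.HeatConduction.PhaseSpace N) → Prop := fun c N T_L T_R μ => MeasureTheory.IsProbabilityMeasure μ ∧ (∀ f : Literature.MathematicalPhysics.KineticTheory.HeatConduction.PhaseSpace N → ℝ, ContDiff ℝ ((⊤ : ℕ∞) : WithTop ℕ∞) f → HasCompactSupport f → ∫ x, L c N T_L T_R f x ∂μ = 0) ∧ ∀ i : Fin N, MeasureTheory.Integrable (J c N i) μ; let Resp : (ℕ → ℝ) → (N : ℕ) → ℝ → ℝ → Prop := fun c N T D => ∃ μ : ℝ → ℝ → MeasureTheory.Measure (Literature.MathematicalPhysics.KineticTheory.HeatConduction.PhaseSpace N), (∀ T_L T_R : ℝ, 0 < T_L → 0 < T_R → SS c N T_L T_R (μ T_L T_R)) ∧ Filter.Tendsto (fun δ : ℝ => (∑ i : Fin N, ∫ x, J c N i x ∂(μ (T + δ / 2) (T - δ / 2))) / δ) (nhdsWithin 0 {(0 : ℝ)}ᶜ) (nhds D); ∀ T : ℝ, 0 < T → ∃ rmin rmax : ℝ, 0 < rmin ∧ rmin ≤ rmax ∧ ∃ k₀ N₀ : ℕ, ∀ N k : ℕ,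 N₀ ≤ N → k < N → ∀ D₀ D₁ : ℝ, Resp (fun i => if i < k then 1 else 0) N T D₀ → Resp (fun i => if i < k + 1 then 1 else 0) N T D₁ → 0 < D₀ ∧ 0 < D₁ ∧ |((N : ℝ) - 1) / D₁ - ((N : ℝ) - 1) / D₀| ≤ rmax ∧ (k₀ ≤ k → k + k₀ < N → rmin ≤ ((N : ℝ) - 1) / D₁ - ((N : ℝ) - 1) / D₀)

/-- item stmt-AtomisticToContinuum-3611 · crux · rank 3 · closed · moot by None · by planner
why it might fail: A quartic cell may be asymptotically transparent: inelastic redistribution without net reflection, or excess resistance → 0 along N via lead resonances at the band edges; near-contact interference only fenced by k₀; no printed theorem compares the n = 1 conductance with fluxCoeff.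
sources: EckmannPilletReyBellet1999b, doi:10.1016/j.physleta.2009.01.054, doi:10.1103/8k6j-kmlj, doi:10.1103/physreve.107.054217, doi:10.1103/physrevlett.88.094302, arXiv:2510.20003
[crux] FIRST RUNG — ONE QUARTIC CELL IN THE HARMONIC CHAIN HAS N-UNIFORM POSITIVE, BOUNDED EXCESS
RESISTANCE (card item SingleImpurity). For ω₂, lam, β, γ > 0 and T > 0 there are 0 < r_min ≤ r_max,
k₀, N₀ with: for all N ≥ N₀ and sites x with k₀ ≤ x, x + k₀ < N, every response coefficient D of the
chain P^{1_{x}} (harmonic except U_x = ω₂q²/2 + lam q⁴/4, V_(x,x+1) = r²/2 + βr⁴/4) at size N and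
temperature T satisfies D > 0 and r_min ≤ (N−1)/D − 1/fluxCoeff ω₂ γ N ≤ r_max, where 1/fluxCoeff ω₂
γ N = R_N(harmonic) is the explicit ballistic resistance (fluxCoeff_eq; harmonicNESS,
integral_bondCurrent_harmonicNESS_eq_fluxCoeff in tree). Physically: the linear-response conductance
of lead–quartic cell–lead is strictly and uniformly below the ballistic value (an anharmonic cell at
temperature T detunes/reflects part of the thermal phonon flux: Hartree shift 3·lam·⟨q²⟩ ⇒
reflection ∝ (lamT)² at leading order) and uniformly positive (V'' ≥ 1: no cell is a mirror).
Technology: one nonlinear oscillator cell driven by two stationary Gaussian fields = finite harmonic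
half-chains ending in Langevin baths (explicit covariance chainCov), n = 1 case of
Eckmann–Pillet–Rey-Bellet; nonlinear Lamb/Rub -/
@[route_item "route-AtomisticToContinuum-MatthiessenIncrements"]
def SingleImpurity : Prop :=
  ∀ ω₂ lam β γ : ℝ, 0 < ω₂ → 0 < lam → 0 < β → 0 < γ → let U : (ℕ → ℝ) → ℕ → ℝ → ℝ := fun c i q => ω₂ * q ^ 2 / 2 + c i * lam * q ^ 4 / 4; let V : (ℕ → ℝ) → ℕ → ℝ → ℝ := fun c i r => r ^ 2 / 2 + c i * β * r ^ 4 / 4; let H : (ℕ → ℝ) → (N : ℕ) → Literature.MathematicalPhysics.KineticTheory.HeatConduction.PhaseSpace N → ℝ := fun c N x => (∑ i : Fin N, (x.2 i ^ 2 / 2 + U c i.val (x.1 i))) + ∑ i : Fin N, ∑ j : Fin N, (if j.val = i.val + 1 then V c i.val (x.1 j - x.1 i) else 0); let L : (ℕ → ℝ) → (N : ℕ) → ℝ → ℝ → (Literature.MathematicalPhysics.KineticTheory.HeatConduction.PhaseSpace N → ℝ) → Literature.MathematicalPhysics.KineticTheory.HeatConduction.PhaseSpace N → ℝ := fun c N T_L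 T_R f x => (∑ i : Fin N, (x.2 i * Literature.MathematicalPhysics.KineticTheory.HeatConduction.partialQ i f x - Literature.MathematicalPhysics.KineticTheory.HeatConduction.partialQ i (H c N) x * Literature.MathematicalPhysics.KineticTheory.HeatConduction.partialP i f x)) + γ * ∑ i : Fin N, ((if i.val = 0 then T_L * Literature.MathematicalPhysics.KineticTheory.HeatConduction.partialP i (Literature.MathematicalPhysics.KineticTheory.HeatConduction.partialP i f) x - x.2 i * Literature.MathematicalPhysics.KineticTheory.HeatConduction.partialP i f x else 0) + (if i.val = N - 1 then T_R * Literature.MathematicalPhysics.KineticTheory.HeatConduction.partialP i (Literature.MathematicalPhysics.KineticTheory.HeatConduction.partialP i f) x - x.2 i * Literature.MathematicalPhysics.KineticTheory.HeatConduction.partialP i f x else 0)); let J : (ℕ → ℝ) → (N : ℕ) → Fin N → Literature.MathematicalPhysics.KineticTheory.HeatConduction.PhaseSpace N → ℝ := fun c N i x => ∑ j : Fin N, (if j.val = i.val + 1 then -((x.2 i + x.2 j) / 2 * deriv (V c i.val) (x.1 j - x.1 i)) else 0); let SS : (ℕ → ℝ) → (N : ℕ) → ℝ → ℝ → MeasureTheory.Measure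 (Literature.MathematicalPhysics.KineticTheory.HeatConduction.PhaseSpace N) → Prop := fun c N T_L T_R μ => MeasureTheory.IsProbabilityMeasure μ ∧ (∀ f : Literature.MathematicalPhysics.KineticTheory.HeatConduction.PhaseSpace N → ℝ, ContDiff ℝ ((⊤ : ℕ∞) : WithTop ℕ∞) f → HasCompactSupport f → ∫ x, L c N T_L T_R f x ∂μ = 0) ∧ ∀ i : Fin N, MeasureTheory.Integrable (J c N i) μ; let Resp : (ℕ → ℝ) → (N : ℕ) → ℝ → ℝ → Prop := fun c N T D => ∃ μ : ℝ → ℝ → MeasureTheory.Measure (Literature.MathematicalPhysics.KineticTheory.HeatConduction.PhaseSpace N), (∀ T_L T_R : ℝ, 0 < T_L → 0 < T_R → SS c N T_L T_R (μ T_L T_R)) ∧ Filter.Tendsto (fun δ : ℝ => (∑ i : Fin N, ∫ x, J c N i x ∂(μ (T + δ / 2) (T - δ / 2))) / δ) (nhdsWithin 0 {(0 : ℝ)}ᶜ) (nhds D); ∀ T : ℝ, 0 < T → ∃ rmin rmax : ℝ, 0 < rmin ∧ rmin ≤ rmax ∧ ∃ k₀ N₀ : ℕ, ∀ N x : ℕ,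 N₀ ≤ N → k₀ ≤ x → x + k₀ < N → ∀ D : ℝ, Resp (fun i => if i = x then 1 else 0) N T D → 0 < D ∧ rmin ≤ ((N : ℝ) - 1) / D - 1 / Literature.MathematicalPhysics.KineticTheory.HeatConduction.fluxCoeff ω₂ γ N ∧ ((N : ℝ) - 1) / D - 1 / Literature.MathematicalPhysics.KineticTheory.HeatConduction.fluxCoeff ω₂ γ N ≤ rmax

/-- item stmt-AtomisticToContinuum-3612 · crux · rank 4 · closed · moot by None · by planner
why it might fail: Weak-class uniqueness has the same unprinted FP-identification gap as NessUnique; existence for non-constant profiles is outside CEHR2018's printed C3 (uniform degrees); a quartic-pinned site with a harmonic left bond (profile jump) may dissipate slowly (HairerMattingly2009).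
sources: CuneoEckmannHairerReyBellet2018, Carmona2007, HairerMattingly2009, ReyBellet2003, HairerMajda2009
[crux] STEADY STATES AND FINITE RESPONSE OF THE MIXED CHAINS (infrastructure that de-vacuifies the
two cruxes above; card item (0)). For ω₂, lam, β, γ > 0 and every cell profile c : ℕ → [0,1]: for
all N and T_L, T_R > 0 the chain P^c has a weak steady state (probability measure, ∫ L^c f dμ = 0
for f ∈ C_c^∞, bond currents integrable) which is unique in that class, and for every N and T > 0
some steady-state family over the bath temperatures has a linear-response limit D = lim_{δ→0,δ≠0}
Σ_i μ_{T+δ/2,T−δ/2}(j_i^c)/δ. For constant c this is NessExistsUnique (0706) +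
FiniteResponseOfUnique (0717) of pinnedChain ω₂ (c·lam) (c·β) γ (existence landed:
CuneoEckmannHairerReyBellet2018_pinnedChain_holds); for general c the Lyapunov/H2 construction of
LangevinChain*.lean must be redone with site-dependent coefficients (interaction degree ≥ pinning
degree holds cellwise since pinning and coupling quartics are switched on together), uniqueness
needs the same Fokker–Planck identification lemma as NessUnique (0741), and the response limit the
Hairer–Majda / Rey-Bellet finite-volume linear-response argument. [difficulty: L] -/
@[route_item "route-AtomisticToContinuum-MatthiessenIncrements"]
def MixedSteadyStates : Prop :=
  ∀ ω₂ lam β γ : ℝ, 0 < ω₂ → 0 < lam → 0 < β → 0 < γ → let U : (ℕ → ℝ) → ℕ → ℝ → ℝ := fun c i q => ω₂ * q ^ 2 / 2 + c i * lam * q ^ 4 / 4; let V : (ℕ → ℝ) → ℕ → ℝ → ℝ := fun c i r => r ^ 2 / 2 + c i * β * r ^ 4 / 4; let H : (ℕ → ℝ) → (N : ℕ) → Literature.MathematicalPhysics.KineticTheory.HeatConduction.PhaseSpace N → ℝ := fun c N x => (∑ i : Fin N, (x.2 i ^ 2 / 2 + U c i.val (x.1 i))) + ∑ i : Fin N, ∑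 j : Fin N, (if j.val = i.val + 1 then V c i.val (x.1 j - x.1 i) else 0); let L : (ℕ → ℝ) → (N : ℕ) → ℝ → ℝ → (Literature.MathematicalPhysics.KineticTheory.HeatConduction.PhaseSpace N → ℝ) → Literature.MathematicalPhysics.KineticTheory.HeatConduction.PhaseSpace N → ℝ := fun c N T_L T_R f x => (∑ i : Fin N, (x.2 i * Literature.MathematicalPhysics.KineticTheory.HeatConduction.partialQ i f x - Literature.MathematicalPhysics.KineticTheory.HeatConduction.partialQ i (H c N) x * Literature.MathematicalPhysics.KineticTheory.HeatConduction.partialP i f x)) + γ * ∑ i : Fin N, ((if i.val = 0 then T_L * Literature.MathematicalPhysics.KineticTheory.HeatConduction.partialP i (Literature.MathematicalPhysics.KineticTheory.HeatConduction.partialP i f) x - x.2 i * Literature.MathematicalPhysics.KineticTheory.HeatConduction.partialP i f x else 0) + (if i.val = N - 1 then T_R * Literature.MathematicalPhysics.KineticTheory.HeatConduction.partialP i (Literature.MathematicalPhysics.KineticTheory.HeatConduction.partialP i f) x - x.2 i * Literature.MathematicalPhysics.KineticTheory.HeatConduction.partialP i f x else 0)); let J : (ℕ → ℝ) → (N : ℕ)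 → Fin N → Literature.MathematicalPhysics.KineticTheory.HeatConduction.PhaseSpace N → ℝ := fun c N i x => ∑ j : Fin N, (if j.val = i.val + 1 then -((x.2 i + x.2 j) / 2 * deriv (V c i.val) (x.1 j - x.1 i)) else 0); let SS : (ℕ → ℝ) → (N : ℕ) → ℝ → ℝ → MeasureTheory.Measure (Literature.MathematicalPhysics.KineticTheory.HeatConduction.PhaseSpace N) → Prop := fun c N T_L T_R μ => MeasureTheory.IsProbabilityMeasure μ ∧ (∀ f : Literature.MathematicalPhysics.KineticTheory.HeatConduction.PhaseSpace N → ℝ, ContDiff ℝ ((⊤ : ℕ∞) : WithTop ℕ∞) f → HasCompactSupport f → ∫ x, L c N T_L T_R f x ∂μ = 0) ∧ ∀ i : Fin N, MeasureTheory.Integrable (J c N i) μ; let Resp : (ℕ → ℝ) → (N : ℕ) → ℝ → ℝ → Prop := fun c N T D => ∃ μ : ℝ → ℝ → MeasureTheory.Measure (Literature.MathematicalPhysics.KineticTheory.HeatConduction.PhaseSpace N), (∀ T_L T_R : ℝ, 0 < T_L → 0 < T_R → SS c N T_L T_R (μ T_L T_R)) ∧ Filter.Tendsto (fun δ : ℝ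 => (∑ i : Fin N, ∫ x, J c N i x ∂(μ (T + δ / 2) (T - δ / 2))) / δ) (nhdsWithin 0 {(0 : ℝ)}ᶜ) (nhds D); ∀ c : ℕ → ℝ, (∀ i : ℕ, 0 ≤ c i ∧ c i ≤ 1) → (∀ (N : ℕ) (T_L T_R : ℝ), 0 < T_L → 0 < T_R → ∃ μ : MeasureTheory.Measure (Literature.MathematicalPhysics.KineticTheory.HeatConduction.PhaseSpace N), SS c N T_L T_R μ ∧ ∀ ν : MeasureTheory.Measure (Literature.MathematicalPhysics.KineticTheory.HeatConduction.PhaseSpace N), SS c N T_L T_R ν → ν = μ) ∧ ∀ (N : ℕ) (T : ℝ), 0 < T → ∃ D : ℝ, Resp c N T D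

/-- item stmt-AtomisticToContinuum-0717 · support · rank 9 · closed · proved by Summit.AtomisticToContinuum.FouriersLaw.Theorems.FourierGreenKubo.finiteResponseOfUnique_holds (prover) · by planner
sources: ReyBellet2003, HairerMajda2009
CONDITIONAL FORM OF 0705 (supersedes it as the prover target; refuters pool-5/g3-0: 0705 stand-alone
quantifies over EVERY steady-state family and is false-prone if weak steady states were non-unique):
assuming UNIQUENESS of weak steady states (IsSteadyState class) for pinnedChain at all N, T_L, T_R >
0, the finite-N linear-response limit D_N(T) = lim_{δ→0, δ≠0} totalCurrent(μ_{N,T+δ/2,T−δ/2})/δ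
exists for every T > 0 and N. Content: differentiability at equilibrium of NESS expectations of the
polynomial currents in the bath temperatures (ReyBellet2003 arXiv:math-ph/0303021 Rem 4.4 (51)–(56)
finite-volume Green–Kubo; HairerMajda2009 arXiv:0909.4313 Thm 2.3 framework — their SDE Thm 4.4
Assumption 5 fails here, so verify Assumptions 1–3 via CEHR2018 (2.5)/Carmona2007 Thm 1.1(iv)
weighted spectral gap). N = 0, 1: totalCurrent ≡ 0, D = 0. Together with 0706 gives 0705. -/
@[route_item "route-AtomisticToContinuum-MatthiessenIncrements"]
def FiniteResponseOfUnique : Prop :=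
  ∀ ω₂ lam β γ : ℝ, 0 < ω₂ → 0 < lam → 0 < β → 0 < γ → (∀ (N : ℕ) (T_L T_R : ℝ), 0 < T_L → 0 < T_R → ∀ μ ν : MeasureTheory.Measure (Literature.MathematicalPhysics.KineticTheory.HeatConduction.PhaseSpace N), (Literature.MathematicalPhysics.KineticTheory.HeatConduction.pinnedChain ω₂ lam β γ).IsSteadyState N T_L T_R μ → (Literature.MathematicalPhysics.KineticTheory.HeatConduction.pinnedChain ω₂ lam β γ).IsSteadyState N T_L T_R ν → μ = ν) → ∀ μ : (N : ℕ) → ℝ → ℝ → MeasureTheory.Measure (Literature.MathematicalPhysics.KineticTheory.HeatConduction.PhaseSpace N), (∀ (N : ℕ) (T_L T_R : ℝ), 0 < T_L → 0 < T_R → (Literature.MathematicalPhysics.KineticTheory.HeatConduction.pinnedChain ω₂ lam β γ).IsSteadyState N T_L T_R (μ N T_L T_R)) → ∀ T : ℝ, 0 < T → ∀ N : ℕ, ∃ D : ℝ, Filter.Tendsto (fun δ : ℝ => (Literature.MathematicalPhysics.KineticTheory.HeatConduction.pinnedChain ω₂ lam β γ).totalCurrent (μ N (T + δ / 2) (T -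 δ / 2)) / δ) (nhdsWithin 0 {(0 : ℝ)}ᶜ) (nhds D)

/-- `FiniteResponseOfUnique` holds: proved by `Summit.AtomisticToContinuum.FouriersLaw.Theorems.FourierGreenKubo.finiteResponseOfUnique_holds`. -/
theorem FiniteResponseOfUnique_holds : FiniteResponseOfUnique := _root_.Summit.AtomisticToContinuum.FouriersLaw.Theorems.FourierGreenKubo.finiteResponseOfUnique_holds

/-- item stmt-AtomisticToContinuum-0741 · support · rank 9 · closed · proved by Summit.AtomisticToContinuum.FouriersLaw.Theorems.nessUnique_proof (prover) · by planner
sources: CuneoEckmannHairerReyBellet2018, Carmona2007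
[crux] UNIQUENESS OF THE WEAK STEADY STATE (the half of stmt-0706 not covered by the landed fact
Literature.MathematicalPhysics.KineticTheory.HeatConduction.CuneoEckmannHairerReyBellet2018_pinnedChain,
p3544): for pinnedChain ω₂ lam β γ (all > 0), every N and T_L, T_R > 0, any two measures in the weak
Fokker–Planck class IsSteadyState (probability, ∫ L f dμ = 0 for f ∈ C_c^∞, bond currents
integrable) coincide. Print: uniqueness of the INVARIANT MEASURE of the Langevin semigroup
(CuneoEckmannHairerReyBellet2018 Thm 2.13(1): C1, C2, CA; Carmona2007 Thm 1.1(iii)); the item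
additionally needs 'weak stationary probability solution of L*μ = 0 ⇒ P_t-invariant' for this
hypoelliptic L with cubic drift (Echeverría 1982 well-posed martingale problem on C_c^∞ +
non-explosion via e^{θH}; Bogachev–Krylov–Röckner–Shaposhnikov 2015 Ch. 5 is non-degenerate only) —
the FP-identification lemma is the formal crux. N = 0: PhaseSpace 0 is a point (unique probability
measure); N = 1: both baths on site 0, OU at temperature (T_L+T_R)/2. This is exactly the hypothesis
of FiniteResponse and ThermodynamicLimit and, with the fact, gives clause (i) of FouriersLawFor. -/
@[route_item "route-AtomisticToContinuum-MatthiessenIncrements"]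
def NessUnique : Prop :=
  ∀ ω₂ lam β γ : ℝ, 0 < ω₂ → 0 < lam → 0 < β → 0 < γ → ∀ (N : ℕ) (T_L T_R : ℝ), 0 < T_L → 0 < T_R → ∀ μ ν : MeasureTheory.Measure (Literature.MathematicalPhysics.KineticTheory.HeatConduction.PhaseSpace N), (Literature.MathematicalPhysics.KineticTheory.HeatConduction.pinnedChain ω₂ lam β γ).IsSteadyState N T_L T_R μ → (Literature.MathematicalPhysics.KineticTheory.HeatConduction.pinnedChain ω₂ lam β γ).IsSteadyState N T_L T_R ν → μ = ν

/-- `NessUnique` holds: proved by `Summit.AtomisticToContinuum.FouriersLaw.Theorems.nessUnique_proof`. -/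
theorem NessUnique_holds : NessUnique := _root_.Summit.AtomisticToContinuum.FouriersLaw.Theorems.nessUnique_proof

/-- item stmt-AtomisticToContinuum-2186 · support · rank 9 · closed · moot by None · by planner
sources: LandimMarianiSeo2018, KunduDharNarayan2009, ReyBellet2003, ArmstrongKuusiMourrat2019
[crux] QUASI-SUBADDITIVITY OF THE LINEAR-RESPONSE RESISTANCE IN THE LENGTH (series law with bounded
junction defect). For pinnedChain ω₂ lam β γ (all > 0), under weak-NESS uniqueness, for every
steady-state family, every T > 0 and the response coefficients D N = lim_{δ→0,δ≠0} totalCurrent(μ N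
(T+δ/2) (T−δ/2))/δ: ∃ C(T) ∀ N, M ≥ 2, (N+M−1)/D_{N+M} ≤ (N−1)/D_N + (M−1)/D_M + C. Here R_N :=
(N−1)/D_N = 1/G_N is the bath-to-bath resistance (physical normalisation; the card's N/D_N differs
by R_N/(N−1) = O(1) under this very crux), and R_N + R_M is EXACTLY the resistance of
(N-chain)–(ideal reservoir at the self-consistent temperature)–(M-chain): replacing the intermediate
reservoir by a direct anharmonic bond raises the resistance by at most a contact constant. Engines:
(a) reservoir-insertion / Büttiker-probe comparison through the open-chain Kubo formula D_N =
(N−1)T⁻² ∫₀^∞ ⟨j_b(0) Σ_i j_i(t)⟩_eq dt (KunduDharNarayan2009; ReyBellet2003 Rem 4.4 (56)) and the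
parity formula for the derivative in the strength of an added bath; (b) gluing admissible trial
pairs in a Dirichlet–Thomson (min–max) representation of ⟨h,(−L)⁻¹h⟩ for L = A_H + γS_baths
(LandimMarianiSeo2018; ArmstrongKuusiMourra -/
@[route_item "route-AtomisticToContinuum-MatthiessenIncrements"]
def QuasiSubadditiveResistance : Prop :=
  ∀ ω₂ lam β γ : ℝ, 0 < ω₂ → 0 < lam → 0 < β → 0 < γ → (∀ (N : ℕ) (T_L T_R : ℝ), 0 < T_L → 0 < T_R → ∀ μ ν : MeasureTheory.Measure (Literature.MathematicalPhysics.KineticTheory.HeatConduction.PhaseSpace N), (Literature.MathematicalPhysics.KineticTheory.HeatConduction.pinnedChain ω₂ lam β γ).IsSteadyState N T_L T_R μ → (Literature.MathematicalPhysics.KineticTheory.HeatConduction.pinnedChain ω₂ lam β γ).IsSteadyState N T_L T_R ν → μ = ν) → ∀ μ : (N : ℕ) → ℝ → ℝ → MeasureTheory.Measure (Literature.MathematicalPhysics.KineticTheory.HeatConduction.PhaseSpace N), (∀ (N : ℕ) (T_L T_R : ℝ), 0 < T_L → 0 < T_R → (Literature.MathematicalPhysics.KineticTheory.HeatConduction.pinnedChain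 ω₂ lam β γ).IsSteadyState N T_L T_R (μ N T_L T_R)) → ∀ T : ℝ, 0 < T → ∀ D : ℕ → ℝ, (∀ N : ℕ, Filter.Tendsto (fun δ : ℝ => (Literature.MathematicalPhysics.KineticTheory.HeatConduction.pinnedChain ω₂ lam β γ).totalCurrent (μ N (T + δ / 2) (T - δ / 2)) / δ) (nhdsWithin 0 {(0 : ℝ)}ᶜ) (nhds (D N))) → ∃ C : ℝ, ∀ N M : ℕ, 2 ≤ N → 2 ≤ M → ((N + M - 1 : ℕ) : ℝ) / D (N + M) ≤ ((N - 1 : ℕ) : ℝ) / D N + ((M - 1 : ℕ) : ℝ) / D M + C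

/-- item stmt-AtomisticToContinuum-2187 · support · rank 9 · closed · moot by None · by planner
sources: BonettoLebowitzReyBellet2000, BonettoLebowitzLukkarinenOlla2009, CanestrariLiveraniOlla2026
[crux] BOUNDED RESPONSE = the catalogued necessary waypoint
Literature.Barriers.AtomisticToContinuum.HasBoundedResponse (pinnedChain ω₂ lam β γ) for all ω₂,
lam, β, γ > 0: along every steady-state family and every T > 0 the finite-size conductivities |D_N|
are bounded in N (J ≤ C δT/N). Necessary for the conjunct (hasBoundedResponse_of_fouriersLawFor,
proved in tree) and FALSE at lam = β = 0 (HarmonicChainBallisticFlux.not_hasBoundedResponse), so any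
proof uses anharmonicity non-perturbatively; under NessUnique the family quantifier collapses to the
canonical family (hasBoundedResponse_iff_of_unique). In the Fekete assembly it is exactly what
upgrades ℓ = lim R_N/N ≥ 0 to ℓ ≥ 1/S > 0, i.e. κ < ∞. This route claims NO new engine for it
(shared residual crux of every FouriersLaw line; the companion cards
insertion-cost-superadditive-half / superadditive-junction-dichotomy reduce it to the superadditive
half of the series law plus one finite-N certificate, conservation-law-rigidity-local-ohm to a local
Ohm inequality). -/
@[route_item "route-AtomisticToContinuum-MatthiessenIncrements"]
def BoundedResponse : Prop :=
  ∀ ω₂ lam β γ : ℝ, 0 < ω₂ → 0 < lam → 0 < β → 0 < γ → Literature.Barriers.AtomisticToContinuum.HasBoundedResponse (Literature.MathematicalPhysics.KineticTheory.HeatConduction.pinnedChain ω₂ lam β γ)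

/-- item stmt-AtomisticToContinuum-2188 · support · rank 9 · closed · moot by None · by planner
sources: ReyBellet2003, EckmannPilletReyBellet1999b, KunduDharNarayan2009
[crux] POSITIVE CONDUCTANCE AT EVERY FINITE LENGTH: under weak-NESS uniqueness, for every
steady-state family, T > 0 and response coefficients D, D_N(T) > 0 for all N ≥ 2 (N = 0, 1 have no
bond, D = 0). Content: the finite-volume Kubo / fluctuation formula D_N = (N−1)T⁻² ∫₀^∞ ⟨j_b(0) Σ_i
j_i(t)⟩_eq dt = lim_t Var(Q_t)/(2tT²) ≥ 0 (ReyBellet2003 Rem 4.4 (56), printed for RBT reservoirs;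
KunduDharNarayan2009 for Langevin baths at physics level) is NON-DEGENERATE: the time-integrated
boundary energy current has diffusive variance because the bath work is not an L²-coboundary of the
equilibrium dynamics; equivalently the strict positivity of entropy production at T_L ≠ T_R
(EckmannPilletReyBellet1999b) survives at first order in δT. Needed so that R_N = (N−1)/D_N ≥
(N−1)/S in the Fekete step (only eventual positivity is necessary for the conjunct; all N ≥ 2 is the
natural fixed-N statement and only D_2 > 0 is used for ℓ < ∞). Fixed-N toolbox:
CuneoEckmannHairerReyBellet2018 Thm 2.13, Carmona2007, HairerMajda2009. -/
@[route_item "route-AtomisticToContinuum-MatthiessenIncrements"]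
def PositiveConductance : Prop :=
  ∀ ω₂ lam β γ : ℝ, 0 < ω₂ → 0 < lam → 0 < β → 0 < γ → (∀ (N : ℕ) (T_L T_R : ℝ), 0 < T_L → 0 < T_R → ∀ μ ν : MeasureTheory.Measure (Literature.MathematicalPhysics.KineticTheory.HeatConduction.PhaseSpace N), (Literature.MathematicalPhysics.KineticTheory.HeatConduction.pinnedChain ω₂ lam β γ).IsSteadyState N T_L T_R μ → (Literature.MathematicalPhysics.KineticTheory.HeatConduction.pinnedChain ω₂ lam β γ).IsSteadyState N T_L T_R ν → μ = ν) → ∀ μ : (N : ℕ) → ℝ → ℝ → MeasureTheory.Measure (Literature.MathematicalPhysics.KineticTheory.HeatConduction.PhaseSpace N), (∀ (N : ℕ) (T_L T_R : ℝ), 0 < T_L → 0 < T_R → (Literature.MathematicalPhysics.KineticTheory.HeatConduction.pinnedChain ω₂ lam β γ).IsSteadyState N T_L T_R (μ N T_L T_R)) → ∀ T : ℝ, 0 < T → ∀ D : ℕ → ℝ, (∀ N : ℕ, Filter.Tendsto (fun δ : ℝ => (Literature.MathematicalPhysics.KineticTheory.HeatConduction.pinnedChain ω₂ lam β γ).totalCurrent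 (μ N (T + δ / 2) (T - δ / 2)) / δ) (nhdsWithin 0 {(0 : ℝ)}ᶜ) (nhds (D N))) → ∀ N : ℕ, 2 ≤ N → 0 < D N

/-- item stmt-AtomisticToContinuum-2189 · support · rank 9 · closed · moot by None · by planner
sources: Hammersley1988, Mathlib: Subadditive.tendsto_lim
[support] FEKETE WITH ADDITIVE DEFECT ON THE INDEX SEMIGROUP {n ≥ 2} (pure real analysis, provable
today; first hypothesis of the Assembly): if a(n+m) ≤ a n + a m + C for all n, m ≥ 2 and (n−1)/S ≤ a
n for n ≥ 2 with S > 0, then a n / n → ℓ for some ℓ > 0 (in fact ℓ = inf_{n≥2} (a n + C)/n ≥ 1/S).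
Proof: b := a + C is subadditive on {n ≥ 2}; for fixed m ≥ 2 write n = qm + r with r ∈ {2,…,m+1}, so
b n ≤ q b m + b r and limsup b n/n ≤ b m/m; hence b n/n → inf ≥ 1/S and a n/n = b n/n − C/n has the
same limit (Mathlib's Subadditive.tendsto_lim is the index-set-ℕ case; ~60 lines by hand). a 0, a 1
are unconstrained. -/
@[route_item "route-AtomisticToContinuum-MatthiessenIncrements"]
def FeketeGlue : Prop :=
  ∀ (a : ℕ → ℝ) (C S : ℝ), 0 < S → (∀ n m : ℕ, 2 ≤ n → 2 ≤ m → a (n + m) ≤ a n + a m + C) → (∀ n : ℕ, 2 ≤ n → ((n - 1 : ℕ) : ℝ) / S ≤ a n) → ∃ ℓ : ℝ, 0 < ℓ ∧ Filter.Tendsto (fun n : ℕ => a n / (n : ℝ)) Filter.atTop (nhds ℓ)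

/-- item stmt-AtomisticToContinuum-3613 · support · rank 9 · closed · moot by None · by planner
sources: BonettoLebowitzReyBellet2000
[support] CALIBRATION OF THE INLINE MIXED CHAIN (provable now; planner-verified: the
constant-profile clauses hold by Iff.rfl/rfl in Sketch.lean). (a) Locality in the profile: if c i =
c' i for all i < N then at size N the weak steady-state predicates of P^c and P^{c'} coincide and
their bond currents are equal; (b) for a constant profile c ≡ a the steady-state predicate IS
(pinnedChain ω₂ (a·lam) (a·β) γ).IsSteadyState and the bond current IS its bondCurrent (so a = 1:
the conjunct's chain up to one_mul; a = 0: the solved harmonic chain up to zero_mul). Used by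
IncrementGlue to identify the two ends of the prefix ladder. [difficulty: provable-now] -/
@[route_item "route-AtomisticToContinuum-MatthiessenIncrements"]
def ProfileCalibration : Prop :=
  ∀ ω₂ lam β γ : ℝ, 0 < ω₂ → 0 < lam → 0 < β → 0 < γ → let U : (ℕ → ℝ) → ℕ → ℝ → ℝ := fun c i q => ω₂ * q ^ 2 / 2 + c i * lam * q ^ 4 / 4; let V : (ℕ → ℝ) → ℕ → ℝ → ℝ := fun c i r => r ^ 2 / 2 + c i * β * r ^ 4 / 4; let H : (ℕ → ℝ) → (N : ℕ) → Literature.MathematicalPhysics.KineticTheory.HeatConduction.PhaseSpace N → ℝ := fun c N x => (∑ i : Fin N, (x.2 i ^ 2 / 2 + U c i.val (x.1 i))) + ∑ i : Fin N, ∑ j : Fin N, (if j.val = i.val + 1 then V c i.val (x.1 j - x.1 i) else 0); let L : (ℕ → ℝ) → (N : ℕ) → ℝ → ℝ → (Literature.MathematicalPhysics.KineticTheory.HeatConduction.PhaseSpace N → ℝ) → Literature.MathematicalPhysics.KineticTheory.HeatConduction.PhaseSpace N → ℝ := fun c N T_L T_R f x => (∑ i : Fin N, (x.2 i * Literature.MathematicalPhysics.KineticTheory.HeatConduction.partialQ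 i f x - Literature.MathematicalPhysics.KineticTheory.HeatConduction.partialQ i (H c N) x * Literature.MathematicalPhysics.KineticTheory.HeatConduction.partialP i f x)) + γ * ∑ i : Fin N, ((if i.val = 0 then T_L * Literature.MathematicalPhysics.KineticTheory.HeatConduction.partialP i (Literature.MathematicalPhysics.KineticTheory.HeatConduction.partialP i f) x - x.2 i * Literature.MathematicalPhysics.KineticTheory.HeatConduction.partialP i f x else 0) + (if i.val = N - 1 then T_R * Literature.MathematicalPhysics.KineticTheory.HeatConduction.partialP i (Literature.MathematicalPhysics.KineticTheory.HeatConduction.partialP i f) x - x.2 i * Literature.MathematicalPhysics.KineticTheory.HeatConduction.partialP i f x else 0)); let J : (ℕ → ℝ) → (N : ℕ) → Fin N → Literature.MathematicalPhysics.KineticTheory.HeatConduction.PhaseSpace N → ℝ := fun c N i x => ∑ j : Fin N, (if j.val = i.val + 1 then -((x.2 i + x.2 j) / 2 * deriv (V c i.val) (x.1 j - x.1 i)) else 0); let SS : (ℕ → ℝ) → (N : ℕ) → ℝ → ℝ → MeasureTheory.Measure (Literature.MathematicalPhysics.KineticTheory.HeatConduction.PhaseSpace N) → Prop := fun c N T_L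 T_R μ => MeasureTheory.IsProbabilityMeasure μ ∧ (∀ f : Literature.MathematicalPhysics.KineticTheory.HeatConduction.PhaseSpace N → ℝ, ContDiff ℝ ((⊤ : ℕ∞) : WithTop ℕ∞) f → HasCompactSupport f → ∫ x, L c N T_L T_R f x ∂μ = 0) ∧ ∀ i : Fin N, MeasureTheory.Integrable (J c N i) μ; (∀ (c c' : ℕ → ℝ) (N : ℕ), (∀ i : ℕ, i < N → c i = c' i) → (∀ (T_L T_R : ℝ) (μ : MeasureTheory.Measure (Literature.MathematicalPhysics.KineticTheory.HeatConduction.PhaseSpace N)), SS c N T_L T_R μ ↔ SS c' N T_L T_R μ) ∧ ∀ i : Fin N, J c N i = J c' N i) ∧ ∀ (a : ℝ) (N : ℕ), (∀ (T_L T_R : ℝ) (μ : MeasureTheory.Measure (Literature.MathematicalPhysics.KineticTheory.HeatConduction.PhaseSpace N)), SS (fun _ => a) N T_L T_R μ ↔ (Literature.MathematicalPhysics.KineticTheory.HeatConduction.pinnedChain ω₂ (a * lam) (a * β) γ).IsSteadyState N T_L T_R μ) ∧ ∀ (i : Fin N) (x : Literature.MathematicalPhysics.KineticTheory.HeatConduction.PhaseSpace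 N), J (fun _ => a) N i x = (Literature.MathematicalPhysics.KineticTheory.HeatConduction.pinnedChain ω₂ (a * lam) (a * β) γ).bondCurrent N i x

/-- item stmt-AtomisticToContinuum-3614 · support · rank 9 · closed · moot by None · by planner
sources: BonettoLebowitzReyBellet2000, Literature.Barriers.AtomisticToContinuum.HasBoundedResponse
[support] TELESCOPING GLUE (the foreseen split of BoundedResponse in this route; finite sums +
ProfileCalibration, provable once stated): PrefixIncrementBounds → MixedSteadyStates →
BoundedResponse. Given a steady-state family μ of pinnedChain ω₂ lam β γ, T > 0 and its response
coefficients D: for N ≥ max(N₀, 2) pick by MixedSteadyStates response coefficients D^(k) of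
P^{1_[0,k)} (k ≤ N; for k = N use D N itself via ProfileCalibration (a)+(b) with a = 1, for k = 0
any response of the harmonic chain, positive by the crux); summing the increments, R_N := (N−1)/D N
≥ (N−1)/D^(0) + (N − 2k₀)·r_min − 2k₀·r_max ≥ (N/2)·r_min for N ≥ N₁, hence 0 < D N ≤ 2/r_min;
finitely many N < N₁ are absorbed in the bound; so BddAbove (range |D N|) for every family, i.e.
HasBoundedResponse. [difficulty: provable-now] -/
@[route_item "route-AtomisticToContinuum-MatthiessenIncrements"]
def IncrementGlue : Prop :=
  PrefixIncrementBounds → MixedSteadyStates → BoundedResponse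

/-- item stmt-AtomisticToContinuum-3615 · assembly · rank 1 · closed · moot by None · by planner
sources: BonettoLebowitzReyBellet2000, CuneoEckmannHairerReyBellet2018
[assembly] FeketeGlue → (fact CuneoEckmannHairerReyBellet2018_pinnedChain) → NessUnique →
FiniteResponseOfUnique → PositiveConductance → QuasiSubadditiveResistance → MixedSteadyStates →
PrefixIncrementBounds → FouriersLaw. -/
@[route_item "route-AtomisticToContinuum-MatthiessenIncrements"]
def Assembly : Prop :=
  FeketeGlue → Literature.MathematicalPhysics.KineticTheory.HeatConduction.CuneoEckmannHairerReyBellet2018_pinnedChain → NessUnique → FiniteResponseOfUnique → PositiveConductance → QuasiSubadditiveResistance → MixedSteadyStates → PrefixIncrementBounds → Literature.MathematicalPhysics.KineticTheory.HeatConduction.FouriersLaw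

end Summit.AtomisticToContinuum.FouriersLaw.Theses.MatthiessenIncrements
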